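import Literature.NumberTheory.Transcendental.KZSemiCanonicalReductionProofs
import Literature.NumberTheory.Transcendental.SemialgebraicMonotonicityDefinable
import Literature.NumberTheory.Transcendental.SemialgebraicAlgebraicPoints
import Literature.NumberTheory.Transcendental.EllIterRep

/-!
# `VolumeFormOffPlane` (stmt-KontsevichZagierPeriods-14935) — line `Sketch`,
stub `stub_dimLeOne`

Target: `Summits/KontsevichZagierPeriods/KontsevichZagierPeriods/Theorems/SymplecticScissorsVolumeFormOffPlaneDimLeOne.lean`.
The theorem `stub_dimLeOne` below keeps EXACTLY the registered signature.

The elementary dimensions `N ≤ 1` of the off-plane frame: two integrand-`1` representations of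
dimension `0` or `1` with equal value are KZ-equivalent. Both dimensions are reduced to ONE
CONSTANT `[pt, f]` (a `0`-dimensional representation on the point `ℝ⁰`) modulo relations:

* `N = 0`: `[r]` is `[pt, f]` or the null `[∅, f] ≡ [pt, 0]`;
* `N = 1` (`dlo_toDimZero`): by o-minimality of the line there are finitely many cut points off
  which open intervals lie inside or outside the domain `σ ⊆ ℝ¹`; keeping only the points where
  membership is not locally constant makes them real-ALGEBRAIC (`isAlgebraic_of_not_mem_nhds`,
  `dlo_exists_finset`); finite volume (integrand `1` is integrable) forces every point of `σ` off
  the cut points into an open cell `(u, v)` inside `σ`, so `[r]` is the sum of its restrictions to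
  these cells up to a finite set (rule (1a), `KZ.of_sub_sum_of_mem_relations`); each cell is the
  closed slab `[u, v]` up to two null points, and ONE Newton–Leibniz move over the point (rule (3),
  primitive `t`, `ℚ`-semialgebraic since `u, v` are algebraic) turns `[[u, v], 1]` into the constant
  `[pt, v − u]` (`dlo_cell`, `dlo_interval`); constants add up by rule (1b) (`dlo_merge`).

Two constants `[pt, f]`, `[pt, f']` with equal value have `f = f'` at the point, hence differ by a
relation (`dlo_point`); values are preserved along relations (soundness).

## References

* M. Kontsevich, D. Zagier, *Periods* (2001), §1.1 (`ℝ⁰` is a point of volume `1`), §1.2 rules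
  (1), (3).
* L. van den Dries, *Tame topology and o-minimal structures* (1998), Ch. 1 (3.2)–(3.3)
  (definable subsets of the line).
-/

noncomputable section

open MeasureTheory Set Filter Topology
open Literature.NumberTheory.Transcendental
open Literature.ModelTheory.ExponentialFields (IsSemialgebraic isSemialgebraic_univ
  exists_Ioo_forall_notMem_of_notMem exists_gt_forall_notMem_Ioo exists_lt_forall_notMem_Ioo)

namespace Summit.KontsevichZagierPeriods.SymplecticScissors.LogPolytope

/-! ## The point `ℝ⁰` -/

/-- In dimension `0` two representations on the point with equal values differ by a relation:
`ℝ⁰` is one point of volume `1`, so the value is the value of the integrand at the point, and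
integrands agreeing on the domain give a relation (rule (1b)). [Kontsevich–Zagier 2001, §1.1]
[folklore] -/
theorem dlo_point {Z Z' : KZ.IntegralRep 0} (hZ : Z.domain = univ) (hZ' : Z'.domain = univ)
    (hv : Z.value = Z'.value) : KZ.of Z - KZ.of Z' ∈ KZ.relations := by
  have hvol : volume (univ : Set (Fin 0 → ℝ)) = 1 := by
    rw [volume_pi, Measure.pi_univ]
    simp
  have hval : ∀ W : KZ.IntegralRep 0, W.domain = univ → W.value = W.integrand default := by
    intro W hW
    have hconst : W.integrand = fun _ => W.integrand default :=
      funext fun x => congrArg W.integrand (Subsingleton.elim x default)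
    rw [KZ.IntegralRep.value, hW, hconst, setIntegral_const]
    simp [measureReal_def, hvol]
  refine KZ.of_sub_of_mem_relations_of_eqOn (by rw [hZ, hZ']) fun x _ => ?_
  rw [Subsingleton.elim x default, ← hval Z hZ, ← hval Z' hZ', hv]

/-! ## The cut points of a `ℚ`-semialgebraic subset of the line -/

/-- **Finitely many ALGEBRAIC cut points.** A `ℚ`-semialgebraic `σ ⊆ ℝ¹` admits a finite set `F` of
real algebraic numbers such that every open interval avoiding `F` lies inside `σ` or is disjoint
from `σ`: o-minimality of the line (`exists_finset_Ioo_subset_or_disjoint`) gives finitely many cut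
points; those at which membership is locally constant are superfluous (connectedness of the
interval), and the remaining ones are non-generic, hence algebraic (`isAlgebraic_of_not_mem_nhds`).
[van den Dries 1998, Ch. 1 (3.3)(ii); Bochnak–Coste–Roy 1998, §2.1] [folklore] -/
theorem dlo_exists_finset (σ : Set (Fin 1 → ℝ)) (hσ : IsSemialgebraic ℚ σ) :
    ∃ F : Finset ℝ, (∀ e ∈ F, IsAlgebraic ℚ e) ∧ ∀ p q : ℝ, (∀ e ∈ F, e ∉ Ioo p q) →
      Ioo p q ⊆ {s | (fun _ : Fin 1 => s) ∈ σ} ∨ Disjoint (Ioo p q) {s | (fun _ : Fin 1 => s) ∈ σ} := by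
  classical
  set A : Set ℝ := {s | (fun _ : Fin 1 => s) ∈ σ} with hA
  have hsa : IsSemialgebraic ℝ {z : Fin 1 → ℝ | z 0 ∈ A} := by
    have : {z : Fin 1 → ℝ | z 0 ∈ A} = σ := by
      ext z
      show (fun _ => z 0) ∈ σ ↔ z ∈ σ
      rw [show (fun _ => z 0 : Fin 1 → ℝ) = z from funext fun i => by rw [Subsingleton.elim i 0]]
    rw [this]
    exact SemialgebraicMonotonicity.isSemialgebraic_real_of hσ
  obtain ⟨F₀, hF₀⟩ := SemialgebraicMonotonicity.exists_finset_Ioo_subset_or_disjoint hsa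
  have hγ : Continuous fun t : ℝ => (fun _ : Fin 1 => t) := continuous_pi fun _ => continuous_id
  refine ⟨F₀.filter (fun x => ¬ ∀ᶠ y in 𝓝 x, (y ∈ A ↔ x ∈ A)), fun e he => ?_, fun p q hpq => ?_⟩
  · obtain ⟨-, he⟩ := Finset.mem_filter.1 he
    refine isAlgebraic_of_not_mem_nhds (x := fun _ : Fin 1 => e) hσ (fun h => he ?_) (fun h => he ?_)
    · have hA' : A ∈ 𝓝 e := hγ.continuousAt.preimage_mem_nhds h
      filter_upwards [hA'] with y hy
      exact iff_of_true hy (mem_of_mem_nhds hA')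
    · have hA' : Aᶜ ∈ 𝓝 e := hγ.continuousAt.preimage_mem_nhds h
      filter_upwards [hA'] with y hy
      exact iff_of_false hy (mem_of_mem_nhds hA')
  · refine FibreLength.subset_or_disjoint_of_isPreconnected isPreconnected_Ioo fun u hu => ?_
    by_contra hloc
    by_cases huF : u ∈ F₀
    · exact hpq u (Finset.mem_filter.2 ⟨huF, hloc⟩) hu
    · obtain ⟨a, b, hau, hub, hab⟩ := exists_Ioo_forall_notMem_of_notMem F₀ huF
      refine hloc ?_
      filter_upwards [Ioo_mem_nhds hau hub] with y hy
      rcases hF₀ a b hab with h | h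
      · exact iff_of_true (h hy) (h ⟨hau, hub⟩)
      · exact iff_of_false (Set.disjoint_left.1 h hy) (Set.disjoint_left.1 h ⟨hau, hub⟩)

/-! ## Rule (3) over the point: slabs and cells are constants -/

/-- **`[[u, v], 1] ≡ [pt, v − u]`** for real algebraic `u ≤ v`: ONE Newton–Leibniz move over the
point `ℝ⁰` (rule (3), primitive `F(t) = t`, bounds the algebraic constants `u`, `v`).
[Kontsevich–Zagier 2001, §1.2, rule (3)] [folklore] -/
theorem dlo_interval {u v : ℝ} (hu : IsAlgebraic ℚ u) (hv : IsAlgebraic ℚ v) (huv : u ≤ v)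
    (I : KZ.IntegralRep 1) (hId : I.domain = {x : Fin 1 → ℝ | x 0 ∈ Icc u v})
    (hIi : I.integrand = fun _ => 1) :
    ∃ z : KZ.IntegralRep 0, z.domain = univ ∧ KZ.of I - KZ.of z ∈ KZ.relations := by
  refine ⟨⟨univ, fun _ => v - u, isSemialgebraic_univ,
    isSemialgebraicFunOn_const_of_isAlgebraic isSemialgebraic_univ (hv.sub hu),
    integrableOn_const (hs := by rw [volume_pi, Measure.pi_univ]; simp)⟩, rfl,
    KZ.newtonLeibnizRel_subset_relations ⟨0, I, _, fun _ => u, fun _ => v,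
      fun w => w (Fin.last 0), by
        simpa using isSemialgebraicFunOn_aeval I.isSemialgebraic_domain
          (MvPolynomial.X (Fin.last 0) : MvPolynomial (Fin 1) ℚ),
      isSemialgebraicFunOn_const_of_isAlgebraic isSemialgebraic_univ hu,
      isSemialgebraicFunOn_const_of_isAlgebraic isSemialgebraic_univ hv, fun _ _ => huv,
      ?_, ?_, ?_, ?_, rfl⟩⟩
  · rw [hId]
    ext x
    simp only [mem_setOf_eq, mem_Icc, mem_univ, true_and]
    rfl
  · intro x _
    simp only [Fin.snoc_last]
    exact continuousOn_id
  · intro x _ t _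
    simp only [Fin.snoc_last, hIi]
    exact hasDerivAt_id' t
  · intro x _
    show v - u = (Fin.snoc x v : Fin 1 → ℝ) (Fin.last 0) - (Fin.snoc x u : Fin 1 → ℝ) (Fin.last 0)
    simp only [Fin.snoc_last]

/-- **An open cell is a constant**: a representation with integrand `1` on the open cell
`{u < x₀ < v}` (`u < v` real algebraic) differs by relations from a constant `[pt, f]` — it is the
closed slab `[[u, v], 1]` up to the two null end points (rule (1)), which is `[pt, v − u]` by
`dlo_interval`. [Kontsevich–Zagier 2001, §1.2] [folklore] -/
theorem dlo_cell (R : KZ.IntegralRep 1) {u v : ℝ} (huv : u < v) (hu : IsAlgebraic ℚ u)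
    (hv : IsAlgebraic ℚ v) (hRd : R.domain = {x : Fin 1 → ℝ | x 0 ∈ Ioo u v})
    (hRi : ∀ x ∈ R.domain, R.integrand x = 1) :
    ∃ z : KZ.IntegralRep 0, z.domain = univ ∧ KZ.of R - KZ.of z ∈ KZ.relations := by
  -- lengths of slabs of `ℝ¹`
  have hvolS : ∀ S : Set ℝ, volume {x : Fin 1 → ℝ | x 0 ∈ S} = volume S := fun S => by
    rw [show {x : Fin 1 → ℝ | x 0 ∈ S} = Set.pi univ (fun _ : Fin 1 => S) by
      ext x; simp [Fin.forall_fin_one], volume_pi_pi]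
    simp
  -- the closed slab `[[u, v], 1]`
  have hIcc : IsSemialgebraic ℚ {x : Fin 1 → ℝ | x 0 ∈ Icc u v} := by
    have h := (KZ.isSemialgebraic_setOf_apply_lt_const hu (0 : Fin 1)).compl.inter
      (KZ.isSemialgebraic_setOf_const_lt_apply hv (0 : Fin 1)).compl
    convert h using 1
    ext x
    simp [not_lt]
  obtain ⟨I, hId, hIi⟩ := KZ.exists_oneRep hIcc
    (by rw [hvolS, Real.volume_Icc]; exact ENNReal.ofReal_ne_top)
  -- `[R] − [I]`: a null modification
  have h1 : KZ.of R - KZ.of I ∈ KZ.relations := by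
    refine KZ.of_sub_of_mem_relations_of_null R I ?_ ?_ fun x hx => ?_
    · rw [hRd, hId, show {x : Fin 1 → ℝ | x 0 ∈ Ioo u v} \ {x | x 0 ∈ Icc u v} = ∅ from
        sdiff_eq_empty.mpr fun x hx => Ioo_subset_Icc_self hx, measure_empty]
    · rw [hRd, hId]
      refine measure_mono_null (fun x hx => ?_)
        (show volume {x : Fin 1 → ℝ | x 0 ∈ ({u, v} : Set ℝ)} = 0 by
          rw [hvolS]; exact (Set.toFinite _).measure_zero _)
      obtain ⟨⟨hux, hxv⟩, h3⟩ := hx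
      simp only [mem_setOf_eq, mem_Ioo, not_and, not_lt] at h3
      rcases hux.lt_or_eq with h | h
      · exact Or.inr (le_antisymm hxv (h3 h))
      · exact Or.inl h.symm
    · rw [hRi x hx.1, hIi]
  -- `[I] − [pt, v − u]`: Newton–Leibniz
  obtain ⟨z, hzd, hz⟩ := dlo_interval hu hv huv.le I hId hIi
  exact ⟨z, hzd, by simpa only [sub_add_sub_cancel] using KZ.relations.add_mem h1 hz⟩

/-- **Constants add up** (rule (1b) on the point): finitely many constants `[pt, fᵢ]` merge into
the one constant `[pt, ∑ fᵢ]` modulo relations. [Kontsevich–Zagier 2001, §1.2, rule (1)]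
[folklore] -/
theorem dlo_merge {ι : Type*} (s : Finset ι) (z : ι → KZ.IntegralRep 0)
    (hz : ∀ i, (z i).domain = univ) :
    ∃ Z : KZ.IntegralRep 0, Z.domain = univ ∧ ∑ i ∈ s, KZ.of (z i) - KZ.of Z ∈ KZ.relations := by
  classical
  induction s using Finset.induction_on with
  | empty =>
    obtain ⟨Z, hZd, hZi⟩ := KZ.exists_zeroRep (n := 0) (isSemialgebraic_univ (k := ℚ))
    refine ⟨Z, hZd, ?_⟩
    simpa using KZ.relations.neg_mem (KZ.of_mem_relations_of_eqOn_zero Z (by simp [hZi, EqOn]))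
  | insert a s ha ih =>
    obtain ⟨Z₁, h₁, e₁⟩ := ih
    let Z : KZ.IntegralRep 0 :=
      { domain := univ
        integrand := (z a).integrand + Z₁.integrand
        isSemialgebraic_domain := isSemialgebraic_univ
        isSemialgebraicFunOn_integrand :=
          IsSemialgebraicFunOn.add_holds (hz a ▸ (z a).isSemialgebraicFunOn_integrand)
            (h₁ ▸ Z₁.isSemialgebraicFunOn_integrand)
        integrableOn := (hz a ▸ (z a).integrableOn).add (h₁ ▸ Z₁.integrableOn) }
    refine ⟨Z, rfl, ?_⟩
    have e₂ : KZ.of Z - KZ.of (z a) - KZ.of Z₁ ∈ KZ.relations :=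
      KZ.integrandAddRel_subset_relations ⟨0, Z, z a, Z₁, hz a, h₁, fun _ _ => rfl, rfl⟩
    rw [Finset.sum_insert ha]
    have : KZ.of (z a) + ∑ i ∈ s, KZ.of (z i) - KZ.of Z =
        (∑ i ∈ s, KZ.of (z i) - KZ.of Z₁) - (KZ.of Z - KZ.of (z a) - KZ.of Z₁) := by abel
    rw [this]
    exact KZ.relations.sub_mem e₁ e₂

/-! ## Dimension one: reduction to one constant -/

/-- **A one-dimensional representation with integrand `1` is a constant modulo relations.** With
the algebraic cut points `F` of `dlo_exists_finset`: by finite volume every point of the domain off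
`F` lies in an open cell of `F` inside the domain, so the representation is the sum of its
restrictions to these cells up to the null set `F` (rule (1)); each cell is a constant (`dlo_cell`)
and constants add up (`dlo_merge`). [van den Dries 1998, Ch. 1 (3.2); Kontsevich–Zagier 2001, §1.2]
[folklore] -/
theorem dlo_toDimZero (r : KZ.IntegralRep 1) (hr : ∀ x ∈ r.domain, r.integrand x = 1) :
    ∃ Z : KZ.IntegralRep 0, Z.domain = univ ∧ KZ.of r - KZ.of Z ∈ KZ.relations := by
  classical
  -- lengths of slabs of `ℝ¹`
  have hvolS : ∀ S : Set ℝ, volume {x : Fin 1 → ℝ | x 0 ∈ S} = volume S := fun S => by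
    rw [show {x : Fin 1 → ℝ | x 0 ∈ S} = Set.pi univ (fun _ : Fin 1 => S) by
      ext x; simp [Fin.forall_fin_one], volume_pi_pi]
    simp
  -- the domain read on the line
  set A : Set ℝ := {s | (fun _ : Fin 1 => s) ∈ r.domain} with hA
  have hdomA : ∀ x : Fin 1 → ℝ, x ∈ r.domain ↔ x 0 ∈ A := fun x => by
    show x ∈ r.domain ↔ (fun _ => x 0) ∈ r.domain
    rw [show (fun _ => x 0 : Fin 1 → ℝ) = x from funext fun i => by rw [Subsingleton.elim i 0]]
  -- finite volume
  have hvol : volume r.domain < ⊤ := by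
    have hint : IntegrableOn (fun _ : Fin 1 → ℝ => (1 : ℝ)) r.domain volume :=
      r.integrableOn.congr_fun (fun x hx => hr x hx) (KZ.IntegralRep.measurableSet_domain_holds r)
    have := (integrableOn_const_iff (C := (1 : ℝ)) (s := r.domain) (μ := volume)).1 hint
    exact this.resolve_left (by simp)
  -- the finitely many algebraic cut points
  obtain ⟨F, hFalg, hF⟩ := dlo_exists_finset r.domain r.isSemialgebraic_domain
  -- finite volume: every point of the domain off `F` lies strictly between two points of `F`
  have hlow : ∀ s ∈ A, s ∉ F → ∃ a ∈ F, a < s := by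
    intro s hs hsF
    by_contra h
    have h : ∀ a ∈ F, s < a := fun a ha =>
      lt_of_le_of_ne (not_lt.1 fun hlt => h ⟨a, ha, hlt⟩) fun e => hsF (e ▸ ha)
    obtain ⟨c, hsc, hc⟩ := exists_gt_forall_notMem_Ioo F s
    have hsub : {x : Fin 1 → ℝ | x 0 ∈ Iio s} ⊆ r.domain := fun x hx => (hdomA x).2 (by
      have hx : x 0 < s := hx
      have hI := (hF (x 0 - 1) c fun e he heI => hc e he ⟨h e he, heI.2⟩).resolve_right
        fun hd => Set.disjoint_left.1 hd ⟨by linarith, hsc⟩ hs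
      exact hI ⟨by linarith, hx.trans hsc⟩)
    have hle := measure_mono (μ := volume) hsub
    rw [hvolS, Real.volume_Iio] at hle
    exact lt_irrefl _ (hle.trans_lt hvol)
  have hupp : ∀ s ∈ A, s ∉ F → ∃ b ∈ F, s < b := by
    intro s hs hsF
    by_contra h
    have h : ∀ b ∈ F, b < s := fun b hb =>
      lt_of_le_of_ne (not_lt.1 fun hlt => h ⟨b, hb, hlt⟩) fun e => hsF (e ▸ hb)
    obtain ⟨c, hcs, hc⟩ := exists_lt_forall_notMem_Ioo F s
    have hsub : {x : Fin 1 → ℝ | x 0 ∈ Ioi s} ⊆ r.domain := fun x hx => (hdomA x).2 (by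
      have hx : s < x 0 := hx
      have hI := (hF c (x 0 + 1) fun e he heI => hc e he ⟨heI.1, h e he⟩).resolve_right
        fun hd => Set.disjoint_left.1 hd ⟨hcs, by linarith⟩ hs
      exact hI ⟨hcs.trans hx, by linarith⟩)
    have hle := measure_mono (μ := volume) hsub
    rw [hvolS, Real.volume_Ioi] at hle
    exact lt_irrefl _ (hle.trans_lt hvol)
  -- the cells of `F` inside `A`, and the restrictions of `r` to them
  set J : Finset (ℝ × ℝ) := (F ×ˢ F).filter
    (fun pq => pq.1 < pq.2 ∧ (∀ y ∈ F, y ∉ Ioo pq.1 pq.2) ∧ Ioo pq.1 pq.2 ⊆ A) with hJ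
  have hJC : ∀ i : J, (i.1.1 ∈ F ∧ i.1.2 ∈ F) ∧ i.1.1 < i.1.2 ∧ (∀ y ∈ F, y ∉ Ioo i.1.1 i.1.2) ∧
      Ioo i.1.1 i.1.2 ⊆ A := fun i => by
    simpa only [hJ, Finset.mem_filter, Finset.mem_product] using i.2
  have hJsa : ∀ i : J, IsSemialgebraic ℚ {x : Fin 1 → ℝ | x 0 ∈ Ioo i.1.1 i.1.2} := fun i =>
    (KZ.isSemialgebraic_setOf_const_lt_apply (hFalg _ (hJC i).1.1) 0).inter
      (KZ.isSemialgebraic_setOf_apply_lt_const (hFalg _ (hJC i).1.2) 0)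
  have hJsub : ∀ i : J, {x : Fin 1 → ℝ | x 0 ∈ Ioo i.1.1 i.1.2} ⊆ r.domain := fun i x hx =>
    (hdomA x).2 ((hJC i).2.2.2 hx)
  set R : J → KZ.IntegralRep 1 := fun i => r.restrict _ (hJsa i) (hJsub i) with hR
  -- rule (1): `[r] − ∑ [R i] ∈ relations` (the cells cover the domain off `F`; they are disjoint)
  have hN : volume {x : Fin 1 → ℝ | x 0 ∈ (F : Set ℝ)} = 0 := by
    rw [hvolS]
    exact F.finite_toSet.measure_zero _
  have key : ∀ i j : J, ∀ t : ℝ, t ∈ Ioo i.1.1 i.1.2 → t ∈ Ioo j.1.1 j.1.2 →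
      j.1.1 ≤ i.1.1 ∧ i.1.2 ≤ j.1.2 := fun i j t hi hj =>
    ⟨not_lt.1 fun h => (hJC i).2.2.1 _ (hJC j).1.1 ⟨h, hj.1.trans hi.2⟩,
      not_lt.1 fun h => (hJC i).2.2.1 _ (hJC j).1.2 ⟨hi.1.trans hj.2, h⟩⟩
  have e1 : KZ.of r - ∑ i, KZ.of (R i) ∈ KZ.relations := by
    refine KZ.of_sub_sum_of_mem_relations Finset.univ r R (fun i _ => ?_) (fun i _ _ _ => rfl)
      ?_ ?_
    · rw [show (R i).domain \ r.domain = ∅ from sdiff_eq_empty.mpr (hJsub i), measure_empty]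
    · refine measure_mono_null (fun x hx => ?_) hN
      by_contra hxF
      have hxA : x 0 ∈ A := (hdomA x).1 hx.1
      obtain ⟨a, ha, hax⟩ := hlow _ hxA hxF
      obtain ⟨b, hb, hxb⟩ := hupp _ hxA hxF
      -- the cell of `F` around `x 0`: the largest cut point below and the smallest one above
      obtain ⟨u, hu, v, hv, hxuv, hav⟩ : ∃ u ∈ F, ∃ v ∈ F, x 0 ∈ Ioo u v ∧ ∀ y ∈ F, y ∉ Ioo u v := by
        have hLn : (F.filter (· < x 0)).Nonempty := ⟨a, Finset.mem_filter.2 ⟨ha, hax⟩⟩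
        have hUn : (F.filter (x 0 < ·)).Nonempty := ⟨b, Finset.mem_filter.2 ⟨hb, hxb⟩⟩
        refine ⟨_, (Finset.mem_filter.1 (Finset.max'_mem _ hLn)).1, _,
          (Finset.mem_filter.1 (Finset.min'_mem _ hUn)).1, ⟨(Finset.mem_filter.1
            (Finset.max'_mem _ hLn)).2, (Finset.mem_filter.1 (Finset.min'_mem _ hUn)).2⟩,
          fun y hy hyI => ?_⟩
        rcases lt_trichotomy y (x 0) with h | h | h
        · exact not_lt_of_ge (Finset.le_max' _ y (Finset.mem_filter.2 ⟨hy, h⟩)) hyI.1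
        · exact hxF (h ▸ hy : x 0 ∈ (F : Set ℝ))
        · exact not_lt_of_ge (Finset.min'_le _ y (Finset.mem_filter.2 ⟨hy, h⟩)) hyI.2
      have hJuv : (u, v) ∈ J :=
        Finset.mem_filter.2 ⟨Finset.mem_product.2 ⟨hu, hv⟩, hxuv.1.trans hxuv.2, hav,
          (hF u v hav).resolve_right fun hd => Set.disjoint_left.1 hd hxuv hxA⟩
      exact hx.2 (mem_iUnion₂.2 ⟨⟨(u, v), hJuv⟩, Finset.mem_univ _, hxuv⟩)
    · intro i _ j _ hij
      rw [show (R i).domain ∩ (R j).domain = ∅ from Set.eq_empty_of_forall_notMem fun x hx =>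
        hij (Subtype.ext (Prod.ext (le_antisymm (key j i _ hx.2 hx.1).1 (key i j _ hx.1 hx.2).1)
          (le_antisymm (key i j _ hx.1 hx.2).2 (key j i _ hx.2 hx.1).2))), measure_empty]
  -- each cell is a constant, and constants add up
  have e2 : ∀ i : J, ∃ z : KZ.IntegralRep 0, z.domain = univ ∧
      KZ.of (R i) - KZ.of z ∈ KZ.relations := fun i =>
    dlo_cell (R i) (hJC i).2.1 (hFalg _ (hJC i).1.1) (hFalg _ (hJC i).1.2) rfl
      fun x hx => hr x (hJsub i hx)
  choose z hzd hz using e2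
  obtain ⟨Z, hZd, hZ⟩ := dlo_merge Finset.univ z hzd
  refine ⟨Z, hZd, ?_⟩
  have : KZ.of r - KZ.of Z = (KZ.of r - ∑ i, KZ.of (R i)) +
      (∑ i, KZ.of (R i) - ∑ i, KZ.of (z i)) + (∑ i, KZ.of (z i) - KZ.of Z) := by abel
  rw [this]
  exact KZ.relations.add_mem (KZ.relations.add_mem e1
    (KZ.sum_sub_sum_mem_relations Finset.univ _ _ fun i _ => hz i)) hZ

/-! ## The stub -/

/-- **Stub (dimensions `N ≤ 1`).** Two integrand-`1` representations of dimension `0` or `1`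
with equal value are KZ-equivalent: both are ONE constant `[pt, f]` modulo relations (`N = 0`:
the domain is the point or empty; `N = 1`: the domain is a.e. a finite disjoint union of open
intervals with real-algebraic end points — non-generic points of a `ℚ`-semialgebraic subset of the
line are algebraic — and each closed interval `[u, v]` is the constant `[pt, v − u]` by one
Newton–Leibniz move, `dlo_toDimZero`); the two constants have equal values (soundness), i.e. equal
integrands at the point, so they differ by a relation. [folklore] -/
theorem stub_dimLeOne : ∀ (N : ℕ), N ≤ 1 → ∀ (r r' : KZ.IntegralRep N),
    (∀ x ∈ r.domain, r.integrand x = 1) → (∀ x ∈ r'.domain, r'.integrand x = 1) →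
    r.value = r'.value → KZ.Equivalent r r' := by
  intro N hN
  -- both dimensions reduce to one constant
  have key : ∀ r : KZ.IntegralRep N, (∀ x ∈ r.domain, r.integrand x = 1) →
      ∃ Z : KZ.IntegralRep 0, Z.domain = univ ∧ KZ.of r - KZ.of Z ∈ KZ.relations := by
    rcases Nat.le_one_iff_eq_zero_or_eq_one.mp hN with rfl | rfl
    · intro r _
      rcases Set.eq_empty_or_nonempty r.domain with h | h
      · obtain ⟨Z, hZd, hZi⟩ := KZ.exists_zeroRep (n := 0) (isSemialgebraic_univ (k := ℚ))
        exact ⟨Z, hZd, KZ.relations.sub_mem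
          (KZ.of_mem_relations_of_volume_eq_zero r (by rw [h, measure_empty]))
          (KZ.of_mem_relations_of_eqOn_zero Z (by simp [hZi, EqOn]))⟩
      · exact ⟨r, Subsingleton.eq_univ_of_nonempty h, by simp [KZ.relations.zero_mem]⟩
    · exact dlo_toDimZero
  intro r r' hr hr' hv
  obtain ⟨Z, hZd, hrZ⟩ := key r hr
  obtain ⟨Z', hZ'd, hrZ'⟩ := key r' hr'
  -- `value Z = value r = value r' = value Z'` (soundness), so the two constants agree
  have h1 : KZ.eval (KZ.of r - KZ.of Z) = 0 := KZ.relations_le_ker_eval_holds hrZ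
  have h2 : KZ.eval (KZ.of r' - KZ.of Z') = 0 := KZ.relations_le_ker_eval_holds hrZ'
  rw [map_sub, KZ.eval_of, KZ.eval_of, sub_eq_zero] at h1 h2
  have hZZ' : KZ.of Z - KZ.of Z' ∈ KZ.relations := dlo_point hZd hZ'd (by rw [← h1, ← h2, hv])
  show KZ.of r - KZ.of r' ∈ KZ.relations
  have : KZ.of r - KZ.of r' =
      (KZ.of r - KZ.of Z) + (KZ.of Z - KZ.of Z') - (KZ.of r' - KZ.of Z') := by abel
  rw [this]
  exact KZ.relations.sub_mem (KZ.relations.add_mem hrZ hZZ') hrZ'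

end Summit.KontsevichZagierPeriods.SymplecticScissors.LogPolytope

end
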